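import Summits.QuantumFields.YangMills.Theses.LangevinControlUV
import Literature.MathematicalPhysics.QuantumFieldTheory.FiniteGaugeGroupTorus
import Literature.Barriers.QuantumFields.DiscreteSubgroupFreezing

/-!
# `FemtoCurvatureTwoPoint`, line `generic-step-gamma-encoding`: the plaquette CHESSBOARD estimate is
# FALSE on odd tori (parity obstruction) — `L = 2^(n+1)` / `Even L` is load-bearing in CHESS / VAR

Negative-side lemma for crux `Summit.QuantumFields.YangMills.Theses.LangevinControlUV.
FemtoCurvatureTwoPoint` (item stmt-QuantumFields-9363; cdisprove gen 3, attack on the picked line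
`Cruxes/FemtoCurvatureTwoPoint/Lines/generic_step_gamma_encoding.lean`, lead c2, reshape 2).

The line's dyadic variance clause VAR (`stub_variance_of_chessboard_doubling`) rests on the
chessboard estimate CHESS (`stub_chessboard_of_RPCS`, conclusion `PlaquetteChessboardDyadic`;
even-torus twin `stub_chessboardEven_of_RPCS`, p114602):
`E_β f(P_0^{01}) ≤ (E_β ∏_x f(P_x^{01}))^{1/L⁴}` for `f ≥ 0` bounded measurable, on tori
`L = 2^(n+1)` (resp. `L` even), for EVERY compact `G` and continuous unitary `ρ`.

* `prod_plaquetteHolonomy_eq_one` — for an abelian gauge group the product of the `(i,j)`-plaquette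
  holonomies over ALL base points of the torus is `1` (every link enters once directly and once
  inverted).
* `exists_plaquette_trivial_of_odd` — on an ODD torus `(ℤ/L)⁴` with gauge group
  `ℤ₂ = rootsOfUnityCircle 2`, every configuration has a base point whose `(0,1)`-plaquette is
  unfrustrated (the fully frustrated `01`-family would have product `(-1)^{L⁴} = -1`).
* `chessboard_lhs_pos_rhs_zero` — consequently, for `f(t) = min |t| 2` (`f ≥ 0`, bounded,
  continuous, `f(0) = 0`, `f(2) = 2`) and the defining character `znRep 2` (`P = 1 − Re z ∈ {0, 2}`):
  `E_β ∏_x f(P_x^{01}) = 0` while `E_β f(P_0^{01}) > 0`, for every `β` and every odd `L ≥ 3`.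
* `plaquetteChessboard_allTori_false` — the chessboard statement with the dyadic / evenness
  restriction on `L` DROPPED (everything else verbatim from `PlaquetteChessboardDyadic`) is FALSE:
  witness `ℤ₂`, `znRep 2`, `L = 3`, `β = 0`, `f = min |·| 2`.

So the parity of `L` is load-bearing for CHESS as typed (all compact `G`): the RP/chessboard route
to the variance rung cannot reach odd tori for general `G`, and the odd-torus variance clause of
`stub_diagUpperRest` (REST) needs either connectedness of `G` (for `SU(2)` the constant quaternion
configuration `U ≡ (iσ₁, iσ₂)` frustrates every plaquette on every torus, so no parity obstruction
exists) or the fixed-torus semiclassics. This does not touch the truth of VAR/REST for Lie `G`.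
-/

noncomputable section

open Filter Topology Finset
open Literature.MathematicalPhysics.QuantumFieldTheory Literature.MathematicalPhysics.QuantumLattice
open Literature.Barriers.QuantumFields

namespace Summit.QuantumFields.YangMills.Theorems.FemtoCurvatureTwoPoint.Negative.ChessboardOddTorus

/-- **Parity identity.** For an abelian gauge group, the product over all base points of the torus
of the plaquette holonomies in a fixed plane is `1`. -/
theorem prod_plaquetteHolonomy_eq_one {d L : ℕ} [NeZero L] {G : Type*} [CommGroup G]
    (U : GaugeConfig d L G) (i j : Fin d) : ∏ x : Site d L, plaquetteHolonomy U x i j = 1 := by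
  have h1 : ∏ x : Site d L, U (x.shift i, j) = ∏ x : Site d L, U (x, j) :=
    Fintype.prod_equiv (Equiv.addRight (Pi.single i (1 : ZMod L) : Site d L)) _ _ (fun _ => rfl)
  have h2 : ∏ x : Site d L, U (x.shift j, i) = ∏ x : Site d L, U (x, i) :=
    Fintype.prod_equiv (Equiv.addRight (Pi.single j (1 : ZMod L) : Site d L)) _ _ (fun _ => rfl)
  simp only [plaquetteHolonomy, Finset.prod_mul_distrib, Finset.prod_inv_distrib, h1, h2]
  rw [mul_comm (∏ x : Site d L, U (x, i)) (∏ x : Site d L, U (x, j)), mul_inv_cancel_right,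
    mul_inv_cancel]

/-- **No fully frustrated `01`-family on an odd `ℤ₂` torus.** Every configuration of the `ℤ₂`
lattice gauge theory on `(ℤ/L)^d`, `L` odd, has a base point with trivial `(i,j)`-plaquette. -/
theorem exists_plaquette_trivial_of_odd {d L : ℕ} [NeZero L] (hL : Odd L)
    (U : GaugeConfig d L (rootsOfUnityCircle 2)) (i j : Fin d) :
    ∃ x : Site d L, plaquetteHolonomy U x i j = 1 := by
  classical
  refine Classical.by_contradiction fun hne => ?_
  have h : ∀ x : Site d L, plaquetteHolonomy U x i j ≠ 1 := fun x hx => hne ⟨x, hx⟩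
  -- every plaquette value is `-1` in `ℂ`
  have hval : ∀ x : Site d L, (((plaquetteHolonomy U x i j : rootsOfUnityCircle 2) : Circle) : ℂ)
      = -1 := by
    intro x
    set z := plaquetteHolonomy U x i j with hz
    have hsq : ((z : Circle) : ℂ) * ((z : Circle) : ℂ) = 1 := by
      have := congrArg (fun u : Circle => (u : ℂ)) (mem_rootsOfUnityCircle.1 z.2)
      simpa [pow_two] using this
    rcases mul_self_eq_one_iff.1 hsq with h1 | h1
    · exfalso
      apply h x
      rw [← hz]
      ext1
      exact Circle.ext (by simpa using h1)
    · exact h1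
  -- the product of all of them is `1` (parity identity) and `(-1)^{L^d}` (all equal), absurd
  have hprod := congrArg (fun u : rootsOfUnityCircle 2 => ((u : Circle) : ℂ))
    (prod_plaquetteHolonomy_eq_one U i j)
  simp only [SubmonoidClass.coe_finsetProd, OneMemClass.coe_one] at hprod
  rw [← Circle.coeHom_apply, map_prod] at hprod
  simp only [Circle.coeHom_apply, hval, Finset.prod_const, Circle.coe_one] at hprod
  have hcard : Fintype.card (Site d L) = L ^ d := by
    simp [Site, ZMod.card]
  rw [Finset.card_univ, hcard] at hprod
  have hodd : Odd (L ^ d) := hL.pow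
  rw [hodd.neg_one_pow] at hprod
  norm_num at hprod

/-- The plaquette field of the `ℤ₂` theory in the form of the crux: `P = 1 − Re z`. -/
theorem plaq_znRep_two (z : rootsOfUnityCircle 2) :
    ((1 : ℕ) : ℝ) - ((znRep 2 z).trace).re = 1 - ((z : Circle) : ℂ).re := by
  simp [znRep_apply, u1Rep_apply, Matrix.trace]

/-- **Odd torus, `ℤ₂`: the chessboard right-hand side vanishes while the left-hand side is
positive.** With `f(t) = min |t| 2` and `P_x = 1 − Re tr znRep 2 (U_{p(x;0,1)})`, for every `β`
and odd `L ≥ 3`: `E_β[∏_x f(P_x)] = 0 < E_β[f(P_0)]`. -/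
theorem chessboard_lhs_pos_rhs_zero {L : ℕ} [NeZero L] (hL : Odd L) (h3 : 3 ≤ L)
    [MeasurableSpace (rootsOfUnityCircle 2)] [BorelSpace (rootsOfUnityCircle 2)] (β : ℝ) :
    wilsonExpectation (d := 4) (L := L) (znRep 2) β (fun U =>
        ∏ x : Fin 4 → ZMod L, min |((1 : ℕ) : ℝ) -
          ((znRep 2) (plaquetteHolonomy U x 0 1)).trace.re| 2) = 0 ∧
    0 < wilsonExpectation (d := 4) (L := L) (znRep 2) β (fun U =>
        min |((1 : ℕ) : ℝ) - ((znRep 2) (plaquetteHolonomy U 0 0 1)).trace.re| 2) := by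
  classical
  haveI : Fact (2 ≤ 2) := ⟨le_rfl⟩
  haveI : Fintype (rootsOfUnityCircle 2) := Fintype.ofFinite _
  constructor
  · -- the integrand vanishes identically: some plaquette is unfrustrated, `f(0) = 0`
    have hzero : (fun U : GaugeConfig 4 L (rootsOfUnityCircle 2) =>
        ∏ x : Fin 4 → ZMod L, min |((1 : ℕ) : ℝ) -
          ((znRep 2) (plaquetteHolonomy U x 0 1)).trace.re| 2) = fun _ => 0 := by
      funext U
      obtain ⟨x, hx⟩ := exists_plaquette_trivial_of_odd hL U 0 1
      apply Finset.prod_eq_zero (Finset.mem_univ x)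
      rw [hx, map_one, Matrix.trace_one]
      simp
    rw [hzero]
    simp [wilsonExpectation]
  · -- the Gibbs average of a non-negative observable with one positive value is positive
    rw [wilsonExpectation_eq_gibbsAverage (znRep 2) (continuous_znRep 2) β]
    have hden : 0 < ∑ U : GaugeConfig 4 L (rootsOfUnityCircle 2),
        Real.exp (-β * wilsonAction (znRep 2) U) :=
      Finset.sum_pos (fun U _ => Real.exp_pos _) Finset.univ_nonempty
    refine div_pos ?_ hden
    -- a configuration with a frustrated plaquette at the origin: flip the link `(0, 0)`
    obtain ⟨g, hg⟩ := exists_ne (1 : rootsOfUnityCircle 2)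
    set U₀ : GaugeConfig 4 L (rootsOfUnityCircle 2) :=
      Function.update (1 : GaugeConfig 4 L (rootsOfUnityCircle 2)) ((0 : Site 4 L), (0 : Fin 4)) g
      with hU₀
    have hL1 : (1 : ZMod L) ≠ 0 := by
      haveI : Fact (1 < L) := ⟨by omega⟩
      exact one_ne_zero
    have he1 : ((0 : Site 4 L).shift 1, (0 : Fin 4)) ≠ ((0 : Site 4 L), (0 : Fin 4)) := by
      intro h
      have h' := congr_fun (congrArg Prod.fst h) 1
      simp [Site.shift] at h'
      exact hL1 h'
    have he2 : ((0 : Site 4 L).shift 0, (1 : Fin 4)) ≠ ((0 : Site 4 L), (0 : Fin 4)) := by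
      intro h
      have h' : (1 : Fin 4) = 0 := congrArg Prod.snd h
      exact absurd h' (by decide)
    have he3 : ((0 : Site 4 L), (1 : Fin 4)) ≠ ((0 : Site 4 L), (0 : Fin 4)) := by
      intro h
      have h' : (1 : Fin 4) = 0 := congrArg Prod.snd h
      exact absurd h' (by decide)
    have hhol : plaquetteHolonomy U₀ 0 0 1 = g := by
      simp only [plaquetteHolonomy, hU₀, Function.update_self, Function.update_of_ne he1,
        Function.update_of_ne he2, Function.update_of_ne he3, Pi.one_apply, inv_one, mul_one]
    -- the value of the observable at `U₀` is `2`
    have hgval : ((g : Circle) : ℂ) = -1 := by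
      have hsq : ((g : Circle) : ℂ) * ((g : Circle) : ℂ) = 1 := by
        have := congrArg (fun u : Circle => (u : ℂ)) (mem_rootsOfUnityCircle.1 g.2)
        simpa [pow_two] using this
      rcases mul_self_eq_one_iff.1 hsq with h1 | h1
      · exfalso; apply hg; ext1; exact Circle.ext (by simpa using h1)
      · exact h1
    have hval : min |((1 : ℕ) : ℝ) - ((znRep 2) (plaquetteHolonomy U₀ 0 0 1)).trace.re| 2 = 2 := by
      rw [hhol, plaq_znRep_two, hgval]
      norm_num
    have hterm : 0 < min |((1 : ℕ) : ℝ) - ((znRep 2) (plaquetteHolonomy U₀ 0 0 1)).trace.re| 2 *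
        Real.exp (-β * wilsonAction (znRep 2) U₀) := by
      rw [hval]; positivity
    refine lt_of_lt_of_le hterm (Finset.single_le_sum (f := fun U =>
      min |((1 : ℕ) : ℝ) - ((znRep 2) (plaquetteHolonomy U 0 0 1)).trace.re| 2 *
        Real.exp (-β * wilsonAction (znRep 2) U)) (fun U _ => ?_) (Finset.mem_univ U₀))
    exact mul_nonneg (le_min (abs_nonneg _) (by norm_num)) (Real.exp_nonneg _)

/-- **The dyadic / evenness restriction in the plaquette chessboard estimate is load-bearing.**
The statement below is `PlaquetteChessboardDyadic` (the conclusion of the line's stub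
`stub_chessboard_of_RPCS`; equally the conclusion of the landed `stub_chessboardEven_of_RPCS`
without `Even L`) with the restriction on `L` DROPPED, everything else verbatim — and it is FALSE:
witness `ℤ₂ = rootsOfUnityCircle 2` with `znRep 2`, the odd torus `L = 3`, `β = 0`,
`f = min |·| 2`. -/
theorem plaquetteChessboard_allTori_false :
    ¬ (∀ (G : Type) [Group G] [TopologicalSpace G] [IsTopologicalGroup G] [CompactSpace G]
        [MeasurableSpace G] [BorelSpace G] (N : ℕ) (ρ : G →* Matrix (Fin N) (Fin N) ℂ),
      Continuous ρ → (∀ g, ρ g ∈ Matrix.unitaryGroup (Fin N) ℂ) →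
      ∀ (L : ℕ) [NeZero L] (β : ℝ), 0 ≤ β →
      ∀ (f : ℝ → ℝ), Measurable f → (∀ t, 0 ≤ f t) → (∃ M : ℝ, ∀ t, f t ≤ M) →
        wilsonExpectation (d := 4) (L := L) ρ β
            (fun U => f ((N : ℝ) - (ρ (plaquetteHolonomy U 0 0 1)).trace.re)) ≤
          (wilsonExpectation (d := 4) (L := L) ρ β
            (fun U => ∏ x : Fin 4 → ZMod L, f ((N : ℝ) - (ρ (plaquetteHolonomy U x 0 1)).trace.re)))
            ^ ((1 : ℝ) / (L : ℝ) ^ 4)) := by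
  intro h
  classical
  haveI : Fact (2 ≤ 2) := ⟨le_rfl⟩
  haveI : NeZero (3 : ℕ) := ⟨by norm_num⟩
  letI : MeasurableSpace (rootsOfUnityCircle 2) := borel _
  haveI : BorelSpace (rootsOfUnityCircle 2) := ⟨rfl⟩
  have hf : Measurable (fun t : ℝ => min |t| 2) := (continuous_abs.min continuous_const).measurable
  have H := h (rootsOfUnityCircle 2) 1 (znRep 2) (continuous_znRep 2) (znRep_mem_unitaryGroup 2)
    3 0 le_rfl (fun t => min |t| 2) hf (fun t => le_min (abs_nonneg t) (by norm_num))
    ⟨2, fun t => min_le_right _ _⟩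
  obtain ⟨hR, hL⟩ := chessboard_lhs_pos_rhs_zero (L := 3) (by decide) le_rfl (0 : ℝ)
  rw [hR, Real.zero_rpow (by norm_num)] at H
  exact absurd H (not_le.2 hL)

end Summit.QuantumFields.YangMills.Theorems.FemtoCurvatureTwoPoint.Negative.ChessboardOddTorus

end
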